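import Summits.Ventures.DiscreteObjects.PP12.FlagSubcells

/-!
# PP(12), flag sub-cell `f = 10`: the Latin-square reduction, TYPED (statement only)
Framing: lottery ticket; floor = certified bounds/negative ranges.

Cell pub-namedobj (venture DiscreteObjects), target (M), designs gen 11. The structure files `FlagExterior` / `FlagTenOddPoint` prove in the
kernel that a flag-type collineation `σ` (`σ³ = 1`) of a projective plane of order 12 with exactly 10 fixed points has 36 exterior points in 12
orbit-triangles, that every exterior line is a side of exactly one triangle with exactly one further ('odd') exterior point, and that the
odd-point relation is a `σ`-equivariant permutation of the exterior points (on orbits: a fixed-point-free permutation `φ⁻¹` without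
2-cycles). The remaining step of the reduction of designs g10 (FAMILY-P5PLANE §7 (c)) / designs g11 (FAMILY-FLAG10 §2 [A]) indexes the 12
exterior orbits by `Fin 12`, the three non-fixed lines through `c` by `ZMod 3`, and reads off from the 108 non-fixed lines through the nine
fixed points `y₁, …, y₉ ≠ c` nine fixed-point-free permutations `q_k` of order 3 such that `{1, φ, φ⁻¹, q₁, …, q₉}` is SHARPLY TRANSITIVE on
`Fin 12` (the rows of a Latin square of order 12): two exterior points in different orbits and on different lines through `c` are joined
either by a side (odd-point relation, `φ^{±1}`) or by exactly one line through exactly one `y_k`.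

This file only TYPES that statement (`FlagTenLatinSquareReduction`, a `Prop`; NOT proved here — the orbit indexing is bookkeeping that
the cell has not formalised) and records how the census uses it: `noFlagTen_of_reduction_of_noLatinSquare` — IF the reduction holds and
no such family of permutations exists (a finite statement about `Sym(12)`; by itself it is satisfiable — designs g10 found completions for
`φ` of type `3⁴` — so the census works with the finer orbit-level system of FAMILY-FLAG10 §3), THEN the sub-cell `f = 10` is empty. No `sorry`;
definitions `flagTenFamily`, `IsFlagTenLatinSquare`, `FlagTenLatinSquareReduction`; theorems `IsFlagTenLatinSquare.phi_fpf` (sharp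
transitivity forces `φ` fixed-point-free without 2-cycles) and the bookkeeping implication `noFlagTen_of_reduction_of_noLatinSquare`.
-/

namespace Summit.Ventures.DiscreteObjects.PP12

open Configuration Finset
open scoped Classical

/-- The family `{1, φ, φ⁻¹, q₀, …, q₈} ⊂ Sym(12)` indexed by `Fin 3 ⊕ Fin 9`. -/
def flagTenFamily (φ : Equiv.Perm (Fin 12)) (q : Fin 9 → Equiv.Perm (Fin 12)) : Fin 3 ⊕ Fin 9 → Equiv.Perm (Fin 12)
  | Sum.inl 0 => 1
  | Sum.inl 1 => φ
  | Sum.inl 2 => φ⁻¹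
  | Sum.inr k => q k

/-- **The Latin-square data of the `f = 10` flag sub-cell** (FAMILY-FLAG10 §2 [A]): `φ ∈ Sym(12)` (odd-point permutation on orbits), nine
fixed-point-free permutations `q_k` of order 3 (the non-fixed lines through the fixed points `y_k`, acting on exterior orbits), such that
`{1, φ, φ⁻¹, q₁, …, q₉}` is sharply transitive: for all orbits `i, i'` exactly one member maps `i` to `i'`. (This forces `φ` to be
fixed-point-free without 2-cycles.) -/
def IsFlagTenLatinSquare (φ : Equiv.Perm (Fin 12)) (q : Fin 9 → Equiv.Perm (Fin 12)) : Prop :=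
  (∀ k : Fin 9, q k ^ 3 = 1 ∧ ∀ i : Fin 12, q k i ≠ i) ∧
  ∀ i i' : Fin 12, ∃! x : Fin 3 ⊕ Fin 9, flagTenFamily φ q x i = i'

/-- **Census statement (typed, NOT proved): the Latin-square reduction of the `f = 10` flag sub-cell.** Every projective plane of order 12 with a
collineation `σ ≠ 1`, `σ³ = 1`, of flag type with exactly 10 fixed points yields Latin-square data `IsFlagTenLatinSquare φ q`
(designs g10 FAMILY-P5PLANE §7 (c), designs g11 FAMILY-FLAG10 §2; the kernel covers the steps up to the odd-point permutation —
`FlagExterior`, `FlagTenOddPoint` — but not the orbit indexing). -/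
def FlagTenLatinSquareReduction : Prop :=
  ∀ (P L : Type) [Membership P L] [Fintype P] [Fintype L] [ProjectivePlane P L],
    ProjectivePlane.order P L = 12 → ∀ σ : Collineation P L, σ.onPoints ^ 3 = 1 → σ.onPoints ≠ 1 →
      (∃ (l : L) (c : P), σ.onLines l = l ∧ σ.onPoints c = c ∧ c ∈ l ∧
          (∀ p : P, σ.onPoints p = p → p ∈ l) ∧ (∀ m : L, σ.onLines m = m → c ∈ m) ∧ fixedCard σ.onPoints = 10) →
      ∃ (φ : Equiv.Perm (Fin 12)) (q : Fin 9 → Equiv.Perm (Fin 12)), IsFlagTenLatinSquare φ q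

/-- Sharp transitivity of `{1, φ, φ⁻¹, q}` forces `φ` to be fixed-point-free and without 2-cycles (the identity, `φ` and `φ⁻¹` must
disagree at every point). -/
theorem IsFlagTenLatinSquare.phi_fpf {φ : Equiv.Perm (Fin 12)} {q : Fin 9 → Equiv.Perm (Fin 12)}
    (h : IsFlagTenLatinSquare φ q) (i : Fin 12) : φ i ≠ i ∧ φ (φ i) ≠ i := by
  obtain ⟨-, huniq⟩ := h
  constructor
  · intro e
    obtain ⟨x, -, hx⟩ := huniq i i
    have h0 : (Sum.inl 0 : Fin 3 ⊕ Fin 9) = x := hx (Sum.inl 0) (by simp [flagTenFamily])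
    have h1 : (Sum.inl 1 : Fin 3 ⊕ Fin 9) = x := hx (Sum.inl 1) (by simpa [flagTenFamily] using e)
    have := h0.trans h1.symm
    simp at this
  · intro e
    obtain ⟨x, -, hx⟩ := huniq i (φ i)
    have h1 : (Sum.inl 1 : Fin 3 ⊕ Fin 9) = x := hx (Sum.inl 1) (by simp [flagTenFamily])
    have h2 : (Sum.inl 2 : Fin 3 ⊕ Fin 9) = x := hx (Sum.inl 2) (by
      show φ⁻¹ i = φ i
      rw [Equiv.Perm.inv_def, Equiv.symm_apply_eq]; exact e.symm)
    have := h1.trans h2.symm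
    simp at this

/-- **How the census would use the reduction:** if the reduction holds and no Latin-square data exists, the sub-cell `f = 10` is empty
(`NoFlagOrder3Order12Fixed 10`). Pure logic, recorded to make the position of [A] in the tree explicit; NOTE that the second hypothesis is
NOT expected to hold on its own (designs g10 reports sharply transitive completions for `φ` of cycle type `3⁴`), which is why the census
decides the finer orbit-level system of FAMILY-FLAG10 §3 (both X-point and X-line sides plus the 81 bijections) instead. -/
theorem noFlagTen_of_reduction_of_noLatinSquare (hred : FlagTenLatinSquareReduction)
    (hno : ∀ (φ : Equiv.Perm (Fin 12)) (q : Fin 9 → Equiv.Perm (Fin 12)), ¬ IsFlagTenLatinSquare φ q) :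
    NoFlagOrder3Order12Fixed 10 := by
  intro P L _ _ _ _ h12 σ hq hne hflag
  obtain ⟨φ, q, h⟩ := hred P L h12 σ hq hne hflag
  exact hno φ q h

end Summit.Ventures.DiscreteObjects.PP12
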